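import Literature.Barriers.SmoothPoincare4.ExoticOpenFourSpaceIsotopyProofs
import Literature.Analysis.Calculus.SardProofs
import HarnessLib

/-!
# `deMichelisFreedman1992_continuum`: "the compactum `K` may be taken to be a smooth codimension zero submanifold" — smooth compact domains between a compactum and an open neighbourhood

Proof file (sibling of `Literature.Barriers.SmoothPoincare4.ExoticOpenFourSpaceIsotopyProofs`)
for the named fact `Literature.Barriers.SmoothPoincare4.deMichelisFreedman1992_continuum`
(DeMichelis–Freedman 1992, Thm. 4.1 with Cor. 4.1).

§0 of the source (p. 220): *"The compactum `K` may be taken to be a smooth codimension zero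
submanifold. For such `K`, it is easily proved that there are only countably many embeddings up to
isotopy …"*; proof of Thm. 4.1 (p. 247): *"The compact set `K ⊂ V₀ ⊂ B` of the introduction should
be chosen to be a smooth codimension zero submanifold large enough so that `V₀ ∖ K ⊂ J₀`"*. The
tree renders "smooth compact codimension zero submanifold of `ℝ⁴`" as
`Literature.Barriers.SmoothPoincare4.IsSmoothCompactDomain` (compact regular sublevel set of a
smooth function, `ExoticOpenFourSpaceProofs`), the shape of `K` in the hypothesis `hcore` of
`deMichelisFreedman1992_countableClasses_of_core` / `…_of_nogo`; the later reductions
(`…_of_polar_nogo`, `…_of_polar_nhdNogo`, `…_of_polar_isotopyNogo`) allow an arbitrary compactum.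
This file proves the general fact behind "may be taken to be" and closes the circle between the
hypothesis shapes:

* `Literature.Barriers.SmoothPoincare4.exists_isSmoothCompactDomain_between` — **between a
  compact set `C` and an open `U ⊇ C` of a finite-dimensional real normed space lies a smooth
  compact domain `K`** (`C ⊆ interior K`, `K ⊆ U`): take a smooth bump `g = 1` on `C` with compact
  support in `U`, a regular value `c ∈ (0, 1)` of `g` (Sard's theorem,
  `Literature.Analysis.Calculus.measure_image_setOf_not_surjective_fderiv_eq_zero`: the critical
  values are Lebesgue-null, `(0, 1)` is not), and `K = {g ≥ c} = {c - g ≤ 0}`.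
* `Literature.Barriers.SmoothPoincare4.polar_core_of_nhdNogo`,
  `Literature.Barriers.SmoothPoincare4.polar_hcore_of_nhdNogo` — for the polar family of an open
  `ℝ⁴`-homeomorph with compactum `K ⊆ R⁴_0` satisfying the neighbourhood no-go, a smooth compact
  domain `K' ⊇ K` inside `R⁴_0` satisfies the no-go ON `K'` for all `s ≠ t` — the hypothesis
  `hcore` of `deMichelisFreedman1992_countableClasses_of_nogo` (`ExoticOpenFourSpaceEmbeddingProofs`),
  so that Thm. 4.1 is re-derived through that route
  (`deMichelisFreedman1992_countableClasses_of_polar_nhdNogo'`).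

## References

* S. DeMichelis, M. H. Freedman, *Uncountably many exotic `R⁴`'s in standard 4-space*,
  J. Differential Geom. 35 (1992) 219–254, §0 (p. 220) and proof of Thm. 4.1 (p. 247).
  [DeMichelisFreedman1992]
* J. M. Lee, *Introduction to Smooth Manifolds*, 2nd ed., GTM 218, Springer (2013), Ch. 5,
  Prop. 5.47 (regular sublevel sets are regular domains). [LeeSmoothManifolds2013]
* A. Sard, *The measure of the critical values of differentiable maps*, Bull. AMS 48 (1942)
  883–890, Thm. 4.1. [Sard1942]

[DeMichelisFreedman1992] [LeeSmoothManifolds2013] [Sard1942]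
-/

noncomputable section

open scoped Manifold ContDiff Topology
open TopologicalSpace Set Filter Function MeasureTheory

namespace Literature.Barriers.SmoothPoincare4

/-! ### Smooth compact domains between a compact set and an open neighbourhood -/

section Domain

variable {E : Type} [NormedAddCommGroup E] [NormedSpace ℝ E] [FiniteDimensional ℝ E]

/-- **A regular value in `(0, 1)`** (Sard): a `C^∞` real function on a finite-dimensional space
has a value `c ∈ (0, 1)` which is not a critical value — the critical values are Lebesgue-null
(`Literature.Analysis.Calculus.measure_image_setOf_not_surjective_fderiv_eq_zero`) while `(0, 1)`
has measure `1`. [cite: Sard1942, Thm. 4.1] -/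
theorem exists_mem_Ioo_not_mem_criticalValues {g : E → ℝ} (hg : ContDiff ℝ ∞ g) :
    ∃ c ∈ Ioo (0 : ℝ) 1, ∀ x, g x = c → Surjective (fderiv ℝ g x) := by
  have hsard : volume (g '' {x ∈ (univ : Set E) | ¬ Surjective (fderiv ℝ g x)}) = 0 :=
    Literature.Analysis.Calculus.measure_image_setOf_not_surjective_fderiv_eq_zero
      (volume : Measure ℝ) isOpen_univ hg.contDiffOn
  by_contra h
  push Not at h
  have hsub : Ioo (0 : ℝ) 1 ⊆ g '' {x ∈ (univ : Set E) | ¬ Surjective (fderiv ℝ g x)} := by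
    intro c hc
    obtain ⟨x, hx, hns⟩ := h c hc
    exact ⟨x, ⟨mem_univ _, hns⟩, hx⟩
  have h1 := measure_mono (μ := (volume : Measure ℝ)) hsub
  rw [hsard, Real.volume_Ioo] at h1
  norm_num at h1

/-- **Between a compact set and an open neighbourhood lies a smooth compact domain** (the general
fact behind DeMichelis–Freedman's "the compactum `K` may be taken to be a smooth codimension zero
submanifold", §0, p. 220; p. 247). For `C ⊆ U ⊆ E` with `C` compact, `U` open and `E` a
finite-dimensional real normed space there is a smooth compact domain `K`
(`IsSmoothCompactDomain`: compact regular sublevel set `{f ≤ 0}` of a `C^∞` function) with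
`C ⊆ interior K` and `K ⊆ U`: `K = {c - g ≤ 0}` for a smooth bump `g` (`= 1` on `C`, compact
support in `U`) and a regular value `c ∈ (0, 1)` of `g` (Sard).
[cite: DeMichelisFreedman1992, §0 (p. 220) and proof of Thm. 4.1 (p. 247)] [cite: LeeSmoothManifolds2013, Ch. 5, Prop. 5.47] [cite: Sard1942, Thm. 4.1] -/
theorem exists_isSmoothCompactDomain_between {C U : Set E} (hC : IsCompact C) (hU : IsOpen U)
    (hCU : C ⊆ U) : ∃ K : Set E, IsSmoothCompactDomain K ∧ C ⊆ interior K ∧ K ⊆ U := by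
  obtain ⟨g, hg, hg1, Cc, hCc, hCcU, hg0⟩ :=
    Literature.Topology.FourManifolds.exists_contDiff_one_of_isCompact hC hU hCU
  obtain ⟨c, ⟨hc0, hc1⟩, hreg⟩ := exists_mem_Ioo_not_mem_criticalValues hg
  have hKCc : {x | c ≤ g x} ⊆ Cc := fun x hx => by
    by_contra hxC
    have h0 : g x = 0 := hg0 x hxC
    have hx' : c ≤ g x := hx
    rw [h0] at hx'
    exact absurd hx' (not_le.mpr hc0)
  refine ⟨{x | c ≤ g x}, ⟨hCc.of_isClosed_subset (isClosed_le continuous_const hg.continuous) hKCc,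
    fun x => c - g x, contDiff_const.sub hg, ?_, fun x hx => ?_⟩, fun x hx => ?_, hKCc.trans hCcU⟩
  · ext x
    simp only [mem_setOf_eq, sub_nonpos]
  · have hgx : g x = c := by linarith
    rw [fderiv_const_sub]
    intro h0
    obtain ⟨v, hv⟩ := hreg x hgx 1
    have h2 : fderiv ℝ g x v = 0 := by
      have := congrArg (fun L : E →L[ℝ] ℝ => L v) h0
      simpa using this
    rw [h2] at hv
    exact zero_ne_one hv
  · refine interior_maximal (fun y (hy : c < g y) => le_of_lt hy)
      (isOpen_lt continuous_const hg.continuous) ?_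
    show c < g x
    rw [hg1 x hx]
    exact hc1

end Domain

/-! ### DeMichelis–Freedman: the compactum of the no-go may be taken to be a smooth compact domain -/

section Polar

/-- Local notation: `𝔼 n` is the model Euclidean space `EuclideanSpace ℝ (Fin n)`. -/
local notation "𝔼 " n:arg => EuclideanSpace ℝ (Fin n)

/-- **"The compactum `K` may be taken to be a smooth codimension zero submanifold"** for the
no-go of the polar family: if for `s < t` in `CS` no diffeomorphism `R⁴_s ≅ R⁴_t` is the identity
near the compactum `K ⊆ R⁴_0`, then for some smooth compact domain `K'` with
`K ⊆ interior K' ⊆ K' ⊆ R⁴_0` (`exists_isSmoothCompactDomain_between`) no diffeomorphism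
`R⁴_s ≅ R⁴_t`, `s ≠ t`, is the identity ON `K'` (`nhdNogo_of_lt` applied to the open
neighbourhood `interior K'` of `K`). [cite: DeMichelisFreedman1992, §0 (p. 220); proof of Thm. 4.1 (p. 247)] -/
theorem polar_core_of_nhdNogo {R : Opens (𝔼 4)} {e : R ≃ₜ 𝔼 4} {K : Set (𝔼 4)}
    (hK : IsCompact K) (hK0 : K ⊆ polarBall R e 0)
    (hno : ∀ s t : cantorSet, s < t →
      ∀ d : polarBall R e (s : ℝ) ≃ₘ⟮𝓡 4, 𝓡 4⟯ polarBall R e (t : ℝ),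
        ∀ W : Set (𝔼 4), IsOpen W → K ⊆ W →
          ∃ x : polarBall R e (s : ℝ), (x : 𝔼 4) ∈ W ∧
            ((d x : polarBall R e (t : ℝ)) : 𝔼 4) ≠ x) :
    ∃ K' : Set (𝔼 4), IsSmoothCompactDomain K' ∧ K ⊆ interior K' ∧ K' ⊆ polarBall R e 0 ∧
      ∀ s t : cantorSet, s ≠ t →
        ∀ d : polarBall R e (s : ℝ) ≃ₘ⟮𝓡 4, 𝓡 4⟯ polarBall R e (t : ℝ),
          ∃ x : polarBall R e (s : ℝ), (x : 𝔼 4) ∈ K' ∧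
            ((d x : polarBall R e (t : ℝ)) : 𝔼 4) ≠ x := by
  obtain ⟨K', hK', hKK', hK'0⟩ :=
    exists_isSmoothCompactDomain_between hK (polarBall R e 0).isOpen hK0
  refine ⟨K', hK', hKK', hK'0, fun s t hst d => ?_⟩
  have hKR : ∀ t : cantorSet, K ⊆ polarBall R e (t : ℝ) := fun t =>
    hK0.trans (polarBall_mono R e (cantorSet_subset_unitInterval t.2).1)
  obtain ⟨x, hx, hdx⟩ := nhdNogo_of_lt (fun t : cantorSet => polarBall R e (t : ℝ)) hKR hno s t
    hst d (interior K') isOpen_interior hKK'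
  exact ⟨x, interior_subset hx, hdx⟩

/-- **The hypothesis `hcore` of `deMichelisFreedman1992_countableClasses_of_nogo` from the
neighbourhood no-go for the polar family**: the polar balls `R⁴_t`, `t ∈ CS` (monotone,
`ℝ⁴`-homeomorphs), the smooth compact domain `K'` of `polar_core_of_nhdNogo` (contained in every
`R⁴_t`), and the no-go on `K'` for `s ≠ t`. [cite: DeMichelisFreedman1992, §0 (p. 220); Thm. 4.1 and its proof (pp. 246–247)] -/
theorem polar_hcore_of_nhdNogo
    (h : ∃ (R : Opens (𝔼 4)) (e : R ≃ₜ 𝔼 4) (K : Set (𝔼 4)), IsCompact K ∧ K ⊆ polarBall R e 0 ∧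
      ∀ s t : cantorSet, s < t →
        ∀ d : polarBall R e (s : ℝ) ≃ₘ⟮𝓡 4, 𝓡 4⟯ polarBall R e (t : ℝ),
          ∀ W : Set (𝔼 4), IsOpen W → K ⊆ W →
            ∃ x : polarBall R e (s : ℝ), (x : 𝔼 4) ∈ W ∧
              ((d x : polarBall R e (t : ℝ)) : 𝔼 4) ≠ x) :
    ∃ (R : cantorSet → Opens (𝔼 4)) (K : Set (𝔼 4)), Monotone R ∧
      (∀ t, Nonempty (R t ≃ₜ 𝔼 4)) ∧ IsSmoothCompactDomain K ∧ (∀ t, K ⊆ R t) ∧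
      ∀ s t, s ≠ t → ∀ d : R s ≃ₘ⟮𝓡 4, 𝓡 4⟯ R t,
        ∃ x : R s, (x : 𝔼 4) ∈ K ∧ ((d x : R t) : 𝔼 4) ≠ x := by
  obtain ⟨R, e, K, hK, hK0, hno⟩ := h
  obtain ⟨K', hK', -, hK'0, hno'⟩ := polar_core_of_nhdNogo hK hK0 hno
  exact ⟨fun t => polarBall R e (t : ℝ), K', fun s t hst => polarBall_mono R e hst,
    fun t => nonempty_polarBall_homeomorph R e (t : ℝ), hK',
    fun t => hK'0.trans (polarBall_mono R e (cantorSet_subset_unitInterval t.2).1), hno'⟩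

/-- **Thm. 4.1 from the neighbourhood no-go, through the smooth-compact-domain route**: the same
conclusion as `deMichelisFreedman1992_countableClasses_of_polar_nhdNogo`, obtained instead via
`polar_hcore_of_nhdNogo` and `deMichelisFreedman1992_countableClasses_of_nogo` (the no-go ON a
smooth compact domain `K`, as on p. 247, with the general fact of the second paragraph for such
`K`) — the hypothesis shapes of the tree's reductions are interchangeable.
[cite: DeMichelisFreedman1992, Thm. 4.1 (p. 246) and its proof (p. 247)] -/
theorem deMichelisFreedman1992_countableClasses_of_polar_nhdNogo'
    (h : ∃ (R : Opens (𝔼 4)) (e : R ≃ₜ 𝔼 4) (K : Set (𝔼 4)), IsCompact K ∧ K ⊆ polarBall R e 0 ∧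
      ∀ s t : cantorSet, s < t →
        ∀ d : polarBall R e (s : ℝ) ≃ₘ⟮𝓡 4, 𝓡 4⟯ polarBall R e (t : ℝ),
          ∀ W : Set (𝔼 4), IsOpen W → K ⊆ W →
            ∃ x : polarBall R e (s : ℝ), (x : 𝔼 4) ∈ W ∧
              ((d x : polarBall R e (t : ℝ)) : 𝔼 4) ≠ x) :
    ∃ R : cantorSet → Opens (𝔼 4), Monotone R ∧ (∀ t, Nonempty (R t ≃ₜ 𝔼 4)) ∧
      ∀ t, {t' | Nonempty (R t' ≃ₘ⟮𝓡 4, 𝓡 4⟯ R t)}.Countable :=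
  deMichelisFreedman1992_countableClasses_of_nogo (polar_hcore_of_nhdNogo h)

end Polar

end Literature.Barriers.SmoothPoincare4

end
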